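import Summits.QuantumFields.YangMills.Theorems.LuscherReductionTwistedTraceScalingMehlerGapBilinear
import HarnessLib

/-!
# C4 INNER, brick O (part 1): the TENSOR model kernel `k(c,c')·K(q,q')` on `C × ℝ^σ` — product integrability and the fibre (Fubini) reduction
# `T(Φ,Ψ) = ∫∫ k(c,c') · Q(Φ_c, Ψ_{c'}) dc dc'`
# (lane A of S-BASE, crux `TwistedTraceScaling` stmt-QuantumFields-20203; sub-target C4, design note `pub/ym-fleet/ym-luscher-20007-p1/COARSE-DESIGN.md` §21.5 O)

The model kernel of the Born–Oppenheimer package is the tensor product of a SLOW kernel `k(c,c') ≥ 0` (the gauge-averaged one-site kernel in the chart; here: any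
bounded symmetric measurable kernel with integrable rows on an s-finite measure space `(C, ν)`) with the STIFF Mehler kernel `K = mehlerKernel a b` on `ℝ^σ`.  For real
`Φ, Ψ ∈ L²(C × ℝ^σ)` the tensor form `T(Φ,Ψ) = ∫∫ Φ(x) k(c,c')K(q,q') Ψ(x') dx' dx` (`x = (c,q)`) reduces to the slow double integral of the FIBREWISE Mehler forms:
* §1 `tensorKernel`, `tensorForm`; the shuffle `((c,q),(c',q')) ↦ ((c,c'),(q,q'))` is measure preserving (`measurePreserving_shuffle`);
* §2 product integrability on `X × X` of `Φ(x)² kK`, `kK Ψ(x')²`, `Φ kK Ψ` (Tonelli, row bounds `μ₁` of `k` and `M` of `K`);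
* §3 ★★ `tensorForm_eq_integral_fibre : T(Φ,Ψ) = ∫_c ∫_{c'} k(c,c') · mehlerForm a b (Φ(c,·)) (Ψ(c',·))`; `integrable_fibre_and_tensorForm_eq` (the fibre
  function is integrable on `C × C` and `T` is its product integral).
Next file (part 2): with `abs_mehlerForm_sub_ground_le` fibrewise and Schur on `k`: `T(Φ,Ψ) = λ₀⟨φ₀, k ψ₀⟩ + O(λ₀ρμ₁‖Φ^⊥‖‖Ψ^⊥‖)` — the STIFF, OFF-DIAGONAL and
model-DIAGONAL clauses of `InnerBOPackageAt`.
HONEST FRAMING: measure-theoretic bookkeeping for a stub of a child of the CONDITIONAL reduction route (femto rung R2b1); not infinite volume, not a gap, not Clay.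

## References
* B. Helffer, *Spectral Theory and its Applications*, CUP 2013, Lemma 7.1 (Schur's test). [Helffer2013]
-/

set_option autoImplicit false

open MeasureTheory Filter Topology
open scoped Real

namespace Summit.QuantumFields.YangMills.Theorems.FemtoTransferGap.Mehler

open Literature.Analysis.SegalBargmann Literature.Analysis.OperatorTheory

noncomputable section

variable {C : Type*} [MeasurableSpace C] {ν : Measure C} [SFinite ν]
variable {σ : Type*} [Fintype σ]

/-! ### §1 The tensor kernel, the tensor form, the shuffle -/

/-- The model kernel `k(c,c') · K(q,q')` on `X = C × ℝ^σ`. [cite: Luscher1983, §3] -/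
def tensorKernel (k : C → C → ℝ) (a b : σ → ℝ) (x x' : C × (σ → ℝ)) : ℝ := k x.1 x'.1 * mehlerKernel a b x.2 x'.2

/-- The tensor form `T(Φ,Ψ) = ∫∫ Φ(x) k(c,c') K(q,q') Ψ(x') dx' dx`. [cite: Luscher1983, §3] -/
def tensorForm (ν : Measure C) (k : C → C → ℝ) (a b : σ → ℝ) (Φ Ψ : C × (σ → ℝ) → ℝ) : ℝ :=
  ∫ x, ∫ x', Φ x * tensorKernel k a b x x' * Ψ x' ∂(ν.prod volume) ∂(ν.prod volume)

/-- The shuffle `((c,q),(c',q')) ↦ ((c,c'),(q,q'))` as a measurable equivalence. [folklore] -/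
def shuffle (C : Type*) [MeasurableSpace C] (Q : Type*) [MeasurableSpace Q] : (C × Q) × (C × Q) ≃ᵐ (C × C) × (Q × Q) where
  toEquiv := Equiv.prodProdProdComm C Q C Q
  measurable_toFun := by
    refine Measurable.prodMk (Measurable.prodMk ?_ ?_) (Measurable.prodMk ?_ ?_)
    · exact measurable_fst.comp measurable_fst
    · exact measurable_fst.comp measurable_snd
    · exact measurable_snd.comp measurable_fst
    · exact measurable_snd.comp measurable_snd
  measurable_invFun := by
    refine Measurable.prodMk (Measurable.prodMk ?_ ?_) (Measurable.prodMk ?_ ?_)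
    · exact measurable_fst.comp measurable_fst
    · exact measurable_fst.comp measurable_snd
    · exact measurable_snd.comp measurable_fst
    · exact measurable_snd.comp measurable_snd

omit [SFinite ν] in
/-- Components of the shuffle. [folklore] -/
@[simp] theorem shuffle_apply {Q : Type*} [MeasurableSpace Q] (p : (C × Q) × (C × Q)) :
    shuffle C Q p = ((p.1.1, p.2.1), (p.1.2, p.2.2)) := rfl

/-- ★ The shuffle is measure preserving: `((ν⊗λ)⊗(ν⊗λ)) ↦ ((ν⊗ν)⊗(λ⊗λ))`. [folklore] -/
theorem measurePreserving_shuffle {Q : Type*} [MeasurableSpace Q] (mQ : Measure Q) [SFinite mQ] :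
    MeasurePreserving (shuffle C Q) ((ν.prod mQ).prod (ν.prod mQ)) ((ν.prod ν).prod (mQ.prod mQ)) := by
  -- `((c,q),(c',q')) ↦ (c,(q,(c',q'))) ↦ (c,((q,c'),q')) ↦ (c,((c',q),q')) ↦ (c,(c',(q,q'))) ↦ ((c,c'),(q,q'))`
  have e1 := measurePreserving_prodAssoc ν mQ (ν.prod mQ)
  have e2 : MeasurePreserving (Prod.map (id : C → C) (MeasurableEquiv.prodAssoc.symm : Q × (C × Q) → (Q × C) × Q))
      (ν.prod (mQ.prod (ν.prod mQ))) (ν.prod ((mQ.prod ν).prod mQ)) :=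
    (MeasurePreserving.id ν).prod (measurePreserving_prodAssoc mQ ν mQ).symm
  have e3 : MeasurePreserving (Prod.map (id : C → C) (Prod.map (Prod.swap : Q × C → C × Q) (id : Q → Q)))
      (ν.prod ((mQ.prod ν).prod mQ)) (ν.prod ((ν.prod mQ).prod mQ)) :=
    (MeasurePreserving.id ν).prod ((Measure.measurePreserving_swap).prod (MeasurePreserving.id mQ))
  have e4 : MeasurePreserving (Prod.map (id : C → C) (MeasurableEquiv.prodAssoc : (C × Q) × Q → C × (Q × Q)))
      (ν.prod ((ν.prod mQ).prod mQ)) (ν.prod (ν.prod (mQ.prod mQ))) :=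
    (MeasurePreserving.id ν).prod (measurePreserving_prodAssoc ν mQ mQ)
  have e5 := (measurePreserving_prodAssoc ν ν (mQ.prod mQ)).symm
  have h := (((e5.comp e4).comp e3).comp e2).comp e1
  have hfun : ((((MeasurableEquiv.prodAssoc.symm : C × (C × (Q × Q)) → (C × C) × (Q × Q)) ∘
      Prod.map (id : C → C) (MeasurableEquiv.prodAssoc : (C × Q) × Q → C × (Q × Q))) ∘
      Prod.map (id : C → C) (Prod.map (Prod.swap : Q × C → C × Q) (id : Q → Q))) ∘
      Prod.map (id : C → C) (MeasurableEquiv.prodAssoc.symm : Q × (C × Q) → (Q × C) × Q)) ∘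
      (MeasurableEquiv.prodAssoc : (C × Q) × (C × Q) → C × (Q × (C × Q))) = ⇑(shuffle C Q) := by
    funext p; rfl
  rw [← hfun]
  exact h

omit [SFinite ν] in
/-- The shuffle composed with a function of `((c,c'),(q,q'))`. [folklore] -/
theorem comp_shuffle_apply {Q : Type*} [MeasurableSpace Q] (G : (C × C) × (Q × Q) → ℝ) (p : (C × Q) × (C × Q)) :
    (G ∘ shuffle C Q) p = G ((p.1.1, p.2.1), (p.1.2, p.2.2)) := rfl

/-! ### §2 Product integrability -/

section Integrability

variable {k : C → C → ℝ} {a b : σ → ℝ} {μ₁ : ℝ}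

omit [MeasurableSpace C] [SFinite ν] in
/-- The tensor kernel is nonnegative. [folklore] -/
theorem tensorKernel_nonneg (hk0 : ∀ c c', 0 ≤ k c c') (a b : σ → ℝ) (x x' : C × (σ → ℝ)) : 0 ≤ tensorKernel k a b x x' :=
  mul_nonneg (hk0 _ _) (mehlerKernel_pos a b _ _).le

omit [MeasurableSpace C] [SFinite ν] in
/-- The tensor kernel is symmetric. [folklore] -/
theorem tensorKernel_comm (hksymm : ∀ c c', k c c' = k c' c) (a b : σ → ℝ) (x x' : C × (σ → ℝ)) :
    tensorKernel k a b x x' = tensorKernel k a b x' x := by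
  unfold tensorKernel; rw [hksymm, mehlerKernel_comm]

omit [SFinite ν] in
/-- The tensor kernel is jointly measurable. [folklore] -/
theorem measurable_tensorKernel (hkm : Measurable (Function.uncurry k)) (a b : σ → ℝ) :
    Measurable fun p : (C × (σ → ℝ)) × (C × (σ → ℝ)) => tensorKernel k a b p.1 p.2 := by
  have h1 : Measurable fun p : (C × (σ → ℝ)) × (C × (σ → ℝ)) => (p.1.1, p.2.1) :=
    (measurable_fst.comp measurable_fst).prodMk (measurable_fst.comp measurable_snd)
  have hk' : Measurable fun p : (C × (σ → ℝ)) × (C × (σ → ℝ)) => Function.uncurry k (p.1.1, p.2.1) := hkm.comp h1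
  have hK' : Measurable fun p : (C × (σ → ℝ)) × (C × (σ → ℝ)) => mehlerKernel a b p.1.2 p.2.2 := by
    unfold mehlerKernel; fun_prop
  have h := hk'.mul hK'
  simp only [Function.uncurry_apply_pair] at h
  exact h

omit [SFinite ν] in
/-- Rows of the tensor kernel are integrable. [folklore] -/
theorem integrable_tensorKernel_right (ha : ∀ i, 0 < a i) (hb : ∀ i, 0 ≤ b i) (hkint : ∀ c, Integrable (k c) ν) (x : C × (σ → ℝ)) :
    Integrable (fun x' => tensorKernel k a b x x') (ν.prod volume) :=
  (hkint x.1).mul_prod (integrable_mehlerKernel_right ha hb x.2)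

/-- `∫ x', kK ≤ μ₁ M`, `M = Π√(π/a_k)`. [folklore] -/
theorem integral_tensorKernel_right_le (ha : ∀ i, 0 < a i) (hb : ∀ i, 0 ≤ b i) (hk0 : ∀ c c', 0 ≤ k c c')
    (hkrow : ∀ c, ∫ c', k c c' ∂ν ≤ μ₁) (x : C × (σ → ℝ)) :
    ∫ x', tensorKernel k a b x x' ∂(ν.prod volume) ≤ μ₁ * ∏ i, Real.sqrt (π / a i) := by
  unfold tensorKernel
  rw [integral_prod_mul (k x.1) (fun q' => mehlerKernel a b x.2 q')]
  have h1 := hkrow x.1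
  have h2 := integral_mehlerKernel_right_le ha hb x.2
  have h3 : 0 ≤ ∫ q', mehlerKernel a b x.2 q' := integral_nonneg fun q' => (mehlerKernel_pos a b _ _).le
  have h4 : 0 ≤ μ₁ := le_trans (integral_nonneg fun c' => hk0 _ _) h1
  exact mul_le_mul h1 h2 h3 h4

/-- `Φ(x)² · kK(x,x')` is integrable on `X × X` for `Φ ∈ L²(X)`. [folklore] -/
theorem integrable_tensorKernel_mul_sq_left (ha : ∀ i, 0 < a i) (hb : ∀ i, 0 ≤ b i) (hk0 : ∀ c c', 0 ≤ k c c') (hkm : Measurable (Function.uncurry k))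
    (hkint : ∀ c, Integrable (k c) ν) (hkrow : ∀ c, ∫ c', k c c' ∂ν ≤ μ₁) {Φ : C × (σ → ℝ) → ℝ} (hΦ : MemLp Φ 2 (ν.prod volume)) :
    Integrable (fun p : (C × (σ → ℝ)) × (C × (σ → ℝ)) => tensorKernel k a b p.1 p.2 * Φ p.1 ^ 2) ((ν.prod volume).prod (ν.prod volume)) := by
  have hmeas : AEStronglyMeasurable (fun p : (C × (σ → ℝ)) × (C × (σ → ℝ)) => tensorKernel k a b p.1 p.2 * Φ p.1 ^ 2) ((ν.prod volume).prod (ν.prod volume)) :=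
    (measurable_tensorKernel hkm a b).aestronglyMeasurable.mul ((hΦ.aestronglyMeasurable.comp_fst).pow 2)
  rw [integrable_prod_iff hmeas]
  refine ⟨ae_of_all _ fun x => ?_, ?_⟩
  · simpa using (integrable_tensorKernel_right ha hb hkint x).mul_const (Φ x ^ 2)
  have hrow : ∀ x, ∫ x', ‖tensorKernel k a b x x' * Φ x ^ 2‖ ∂(ν.prod volume) = Φ x ^ 2 * ∫ x', tensorKernel k a b x x' ∂(ν.prod volume) := fun x => by
    have : (fun x' => ‖tensorKernel k a b x x' * Φ x ^ 2‖) = fun x' => tensorKernel k a b x x' * Φ x ^ 2 := by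
      funext x'; rw [Real.norm_eq_abs, abs_of_nonneg (mul_nonneg (tensorKernel_nonneg hk0 a b x x') (sq_nonneg _))]
    rw [this, integral_mul_const, mul_comm]
  simp_rw [hrow]
  refine ((hΦ.integrable_sq).mul_const (μ₁ * ∏ i, Real.sqrt (π / a i))).mono' ?_ (ae_of_all _ fun x => ?_)
  · exact (hmeas.norm.integral_prod_right').congr (ae_of_all _ fun x => hrow x)
  · rw [Real.norm_eq_abs, abs_of_nonneg (mul_nonneg (sq_nonneg _) (integral_nonneg fun x' => tensorKernel_nonneg hk0 a b x x'))]
    exact mul_le_mul_of_nonneg_left (integral_tensorKernel_right_le ha hb hk0 hkrow x) (sq_nonneg _)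

/-- `kK(x,x') · Ψ(x')²` is integrable on `X × X` for `Ψ ∈ L²(X)`. [folklore] -/
theorem integrable_tensorKernel_mul_sq_right (ha : ∀ i, 0 < a i) (hb : ∀ i, 0 ≤ b i) (hk0 : ∀ c c', 0 ≤ k c c') (hksymm : ∀ c c', k c c' = k c' c)
    (hkm : Measurable (Function.uncurry k)) (hkint : ∀ c, Integrable (k c) ν) (hkrow : ∀ c, ∫ c', k c c' ∂ν ≤ μ₁) {Ψ : C × (σ → ℝ) → ℝ}
    (hΨ : MemLp Ψ 2 (ν.prod volume)) :
    Integrable (fun p : (C × (σ → ℝ)) × (C × (σ → ℝ)) => tensorKernel k a b p.1 p.2 * Ψ p.2 ^ 2) ((ν.prod volume).prod (ν.prod volume)) := by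
  have h := (integrable_tensorKernel_mul_sq_left ha hb hk0 hkm hkint hkrow hΨ).swap
  refine h.congr (ae_of_all _ fun p => ?_)
  simp only [Function.comp_apply, Prod.fst_swap, Prod.snd_swap]
  rw [tensorKernel_comm hksymm]

/-- `Φ(x) · kK(x,x') · Ψ(x')` is integrable on `X × X`. [folklore] -/
theorem integrable_tensorForm_integrand (ha : ∀ i, 0 < a i) (hb : ∀ i, 0 ≤ b i) (hk0 : ∀ c c', 0 ≤ k c c') (hksymm : ∀ c c', k c c' = k c' c)
    (hkm : Measurable (Function.uncurry k)) (hkint : ∀ c, Integrable (k c) ν) (hkrow : ∀ c, ∫ c', k c c' ∂ν ≤ μ₁) {Φ Ψ : C × (σ → ℝ) → ℝ}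
    (hΦ : MemLp Φ 2 (ν.prod volume)) (hΨ : MemLp Ψ 2 (ν.prod volume)) :
    Integrable (fun p : (C × (σ → ℝ)) × (C × (σ → ℝ)) => Φ p.1 * tensorKernel k a b p.1 p.2 * Ψ p.2) ((ν.prod volume).prod (ν.prod volume)) := by
  have hmeas : AEStronglyMeasurable (fun p : (C × (σ → ℝ)) × (C × (σ → ℝ)) => Φ p.1 * tensorKernel k a b p.1 p.2 * Ψ p.2) ((ν.prod volume).prod (ν.prod volume)) :=
    (hΦ.aestronglyMeasurable.comp_fst.mul (measurable_tensorKernel hkm a b).aestronglyMeasurable).mul hΨ.aestronglyMeasurable.comp_snd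
  refine (((integrable_tensorKernel_mul_sq_left ha hb hk0 hkm hkint hkrow hΦ).add
    (integrable_tensorKernel_mul_sq_right ha hb hk0 hksymm hkm hkint hkrow hΨ)).div_const 2).mono' hmeas (ae_of_all _ fun p => ?_)
  rw [Real.norm_eq_abs, abs_mul, abs_mul, abs_of_nonneg (tensorKernel_nonneg hk0 a b p.1 p.2)]
  have hK := tensorKernel_nonneg hk0 a b p.1 p.2
  have h2 : 2 * (|Φ p.1| * |Ψ p.2|) ≤ Φ p.1 ^ 2 + Ψ p.2 ^ 2 := by
    rw [← sq_abs (Φ p.1), ← sq_abs (Ψ p.2)]; nlinarith [sq_nonneg (|Φ p.1| - |Ψ p.2|)]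
  have := mul_le_mul_of_nonneg_left h2 hK
  simp only [Pi.add_apply] at *
  nlinarith

end Integrability

/-! ### §3 ★★ The fibre reduction -/

section Fibre

variable {k : C → C → ℝ} {a b : σ → ℝ} {μ₁ : ℝ}

/-- ★★ **Fibre (Fubini) reduction of the tensor form**: for `Φ, Ψ ∈ L²(C × ℝ^σ)`,
`T(Φ,Ψ) = ∫_c ∫_{c'} k(c,c') · mehlerForm a b (Φ(c,·)) (Ψ(c',·)) dν dν`. [cite: Luscher1983, §3] -/
theorem tensorForm_eq_integral_fibre (ha : ∀ i, 0 < a i) (hb : ∀ i, 0 ≤ b i) (hk0 : ∀ c c', 0 ≤ k c c') (hksymm : ∀ c c', k c c' = k c' c)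
    (hkm : Measurable (Function.uncurry k)) (hkint : ∀ c, Integrable (k c) ν) (hkrow : ∀ c, ∫ c', k c c' ∂ν ≤ μ₁) {Φ Ψ : C × (σ → ℝ) → ℝ}
    (hΦ : MemLp Φ 2 (ν.prod volume)) (hΨ : MemLp Ψ 2 (ν.prod volume)) :
    tensorForm ν k a b Φ Ψ = ∫ c, ∫ c', k c c' * mehlerForm a b (fun q => Φ (c, q)) (fun q' => Ψ (c', q')) ∂ν ∂ν := by
  set F : (C × (σ → ℝ)) × (C × (σ → ℝ)) → ℝ := fun p => Φ p.1 * tensorKernel k a b p.1 p.2 * Ψ p.2 with hF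
  have hFint : Integrable F ((ν.prod volume).prod (ν.prod volume)) := integrable_tensorForm_integrand ha hb hk0 hksymm hkm hkint hkrow hΦ hΨ
  -- the shuffled integrand
  set G : (C × C) × ((σ → ℝ) × (σ → ℝ)) → ℝ := fun r => Φ (r.1.1, r.2.1) * (k r.1.1 r.1.2 * mehlerKernel a b r.2.1 r.2.2) * Ψ (r.1.2, r.2.2) with hG
  have hGF : G ∘ shuffle C (σ → ℝ) = F := by
    funext p; rfl
  have hsh := measurePreserving_shuffle (ν := ν) (volume : Measure (σ → ℝ))
  have hGint : Integrable G ((ν.prod ν).prod ((volume : Measure (σ → ℝ)).prod volume)) := by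
    rw [← hsh.integrable_comp_emb (shuffle C (σ → ℝ)).measurableEmbedding, hGF]; exact hFint
  -- `T = ∫ F = ∫ G`
  have h1 : tensorForm ν k a b Φ Ψ = ∫ r, G r ∂((ν.prod ν).prod ((volume : Measure (σ → ℝ)).prod volume)) := by
    rw [tensorForm, ← integral_prod _ hFint, ← hsh.integral_comp', ← hGF]
    rfl
  rw [h1, integral_prod _ hGint]
  -- for a.e. `(c,c')`: the inner `(q,q')`-integral is `k(c,c') · mehlerForm`
  have hae : ∀ᵐ cc ∂(ν.prod ν), ∫ qq, G (cc, qq) ∂((volume : Measure (σ → ℝ)).prod volume) =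
      k cc.1 cc.2 * mehlerForm a b (fun q => Φ (cc.1, q)) (fun q' => Ψ (cc.2, q')) := by
    filter_upwards [hGint.prod_right_ae] with cc hcc
    rw [integral_prod _ hcc, mehlerForm, ← integral_const_mul]
    refine integral_congr_ae (ae_of_all _ fun q => ?_)
    dsimp only
    rw [← integral_const_mul]
    refine integral_congr_ae (ae_of_all _ fun q' => ?_)
    dsimp only [hG]
    ring
  rw [integral_congr_ae hae]
  rw [integral_prod _ (hGint.integral_prod_left.congr hae)]

/-- ★ The fibre function `(c,c') ↦ k(c,c') · mehlerForm a b (Φ(c,·)) (Ψ(c',·))` is integrable on `C × C`, and the tensor form is its product integral.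
[cite: Luscher1983, §3] -/
theorem integrable_fibre_and_tensorForm_eq (ha : ∀ i, 0 < a i) (hb : ∀ i, 0 ≤ b i) (hk0 : ∀ c c', 0 ≤ k c c') (hksymm : ∀ c c', k c c' = k c' c)
    (hkm : Measurable (Function.uncurry k)) (hkint : ∀ c, Integrable (k c) ν) (hkrow : ∀ c, ∫ c', k c c' ∂ν ≤ μ₁) {Φ Ψ : C × (σ → ℝ) → ℝ}
    (hΦ : MemLp Φ 2 (ν.prod volume)) (hΨ : MemLp Ψ 2 (ν.prod volume)) :
    Integrable (fun cc : C × C => k cc.1 cc.2 * mehlerForm a b (fun q => Φ (cc.1, q)) (fun q' => Ψ (cc.2, q'))) (ν.prod ν) ∧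
      tensorForm ν k a b Φ Ψ = ∫ cc, k cc.1 cc.2 * mehlerForm a b (fun q => Φ (cc.1, q)) (fun q' => Ψ (cc.2, q')) ∂(ν.prod ν) := by
  set F : (C × (σ → ℝ)) × (C × (σ → ℝ)) → ℝ := fun p => Φ p.1 * tensorKernel k a b p.1 p.2 * Ψ p.2 with hF
  have hFint : Integrable F ((ν.prod volume).prod (ν.prod volume)) := integrable_tensorForm_integrand ha hb hk0 hksymm hkm hkint hkrow hΦ hΨ
  set G : (C × C) × ((σ → ℝ) × (σ → ℝ)) → ℝ := fun r => Φ (r.1.1, r.2.1) * (k r.1.1 r.1.2 * mehlerKernel a b r.2.1 r.2.2) * Ψ (r.1.2, r.2.2) with hG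
  have hGF : G ∘ shuffle C (σ → ℝ) = F := by
    funext p; rfl
  have hsh := measurePreserving_shuffle (ν := ν) (volume : Measure (σ → ℝ))
  have hGint : Integrable G ((ν.prod ν).prod ((volume : Measure (σ → ℝ)).prod volume)) := by
    rw [← hsh.integrable_comp_emb (shuffle C (σ → ℝ)).measurableEmbedding, hGF]; exact hFint
  have hae : ∀ᵐ cc ∂(ν.prod ν), ∫ qq, G (cc, qq) ∂((volume : Measure (σ → ℝ)).prod volume) =
      k cc.1 cc.2 * mehlerForm a b (fun q => Φ (cc.1, q)) (fun q' => Ψ (cc.2, q')) := by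
    filter_upwards [hGint.prod_right_ae] with cc hcc
    rw [integral_prod _ hcc, mehlerForm, ← integral_const_mul]
    refine integral_congr_ae (ae_of_all _ fun q => ?_)
    dsimp only
    rw [← integral_const_mul]
    refine integral_congr_ae (ae_of_all _ fun q' => ?_)
    dsimp only [hG]
    ring
  refine ⟨hGint.integral_prod_left.congr hae, ?_⟩
  have h1 : tensorForm ν k a b Φ Ψ = ∫ r, G r ∂((ν.prod ν).prod ((volume : Measure (σ → ℝ)).prod volume)) := by
    rw [tensorForm, ← integral_prod _ hFint, ← hsh.integral_comp', ← hGF]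
    rfl
  rw [h1, integral_prod _ hGint]
  exact integral_congr_ae hae

end Fibre

end

end Summit.QuantumFields.YangMills.Theorems.FemtoTransferGap.Mehler
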